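import Summits.Ventures.PercRepro.S2SpreadSixteenSeven
import Summits.Ventures.PercRepro.S2CoreSeventeenSplit

/-!
# PercRepro — S2: THE COLOOP CASE OF `(16, 7)` (THE SCALED CELL `(15, 7)`) AND THE CELL `(16, 7)` IN FULL (p7, gen 10; sub-claim S2; the `p = 16` row)

A coloop `e` of the `(16, 7)` core is split off as in the kit (`delete_core_data`, `weighted_of_isColoop_scaled`): `M ＼ {e}` is an
`e`-free core of rank `15` on `22` points (corank `7`, coloops allowed) and the cell reads with the weight `Φ(16, 5)/2 ≤ 2^20/C(21, 5)`
(the kit's scaled `(15, 7)` cell: `1.023`, open). The same dichotomy closes it, on the kit's standard caps `11 / 69 / 401`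
(`TriangleCap.cq3 7`, `avgChain16 7`, `S1.avgChain5b 7`; tail `T = 423,728`, slack `m = 104`, need `73,129`):
* concentrated — a set `W` with `(ν(W), |W|) ∈ {(6, ≤ 15), (5, ≤ 11)}`: the `5`-set payment `V(w, k) ≤ 15,030`
  (`12,558` at `(15, 6)`, `13,167` at `(11, 5)`) against the charge `2·28,957 + 924/5` on the `6`- and `7`-sets:
  **`c025_fifteen_seven_scaled_of_nullity_six`**, **`…_of_nullity_five`**;
* spread — no such `W`: every set of rank `≤ r ≤ 5` has `≤ r + 4` points (**`S2.ncard_le_of_eRk_le_of_not_concentrated_two`**: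
  `≥ r + 5` points give nullity `≥ 5` and a descent `W'` of nullity `5 / 6` on `≤ 10 / 11` points), so `f = 9`, `f' = 8` and the
  `7`-sets weigh `3/5`: `#U(15, 5) ≤ C(22, 5) + C(11, 2) + (8/5)·28,957 = 72,720.2` (**`topCount_le_spread_fifteen_seven`**:
  `≤ 72,721`) against `73,129`: **`c025_fifteen_seven_scaled_of_spread`**.
**`c025_fifteen_seven_scaled`** is the scaled cell; **`c025_sixteen_seven_of_coloop`** lifts it through the coloop; with
S2SpreadSixteenSeven's coloop-free cell, **`c025_core_five_sixteen_seven (M) (hR : ρ(E) = 16) (hn : |E| = 23) (hfree) : RLS M 16 5`**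
— THE CELL `(16, 7)` OF THE `q = 5` WINDOW, IN FULL. Axioms: standard.
-/

open scoped Matroid

namespace PercRepro

namespace S2

open Set

variable {α : Type}

/-- **The flat bound on a core with no `W` of `(ν(W), |W|) ∈ {(6, ≤ 15), (5, ≤ 11)}`**: every set of rank `≤ r ≤ 5` has at
most `r + 4` points (a set with `≥ r + 5` points has nullity `≥ 5`; descent to nullity `5` or `6`). -/
theorem ncard_le_of_eRk_le_of_not_concentrated_two (M : Matroid α) [M.Finite]
    (hns : ¬ ∃ W ⊆ M.E, (W.ncard ≤ 15 ∧ W.encard = M.eRk W + 6) ∨ (W.ncard ≤ 11 ∧ W.encard = M.eRk W + 5))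
    {X : Set α} (hX : X ⊆ M.E) {r : ℕ} (hr5 : r ≤ 5) (hXr : M.eRk X ≤ r) : X.ncard ≤ r + 4 := by
  classical
  by_contra hbig
  push Not at hbig
  have hXfin : X.Finite := M.ground_finite.subset hX
  have key : ∀ k : ℕ, r + k ≤ X.ncard → ∃ W' ⊆ M.E, W'.ncard ≤ r + k ∧ W'.encard = M.eRk W' + k := by
    intro k hk
    have hk' : M.eRk X + k ≤ X.encard := by
      calc M.eRk X + k ≤ (r : ℕ∞) + k := by gcongr
        _ = ((r + k : ℕ) : ℕ∞) := by push_cast; rfl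
        _ ≤ (X.ncard : ℕ∞) := by exact_mod_cast hk
        _ = X.encard := hXfin.cast_ncard_eq
    obtain ⟨W', hW'X, hW'⟩ := exists_subset_encard_eq_eRk_add M hX k hk'
    have hW'fin : W'.Finite := hXfin.subset hW'X
    refine ⟨W', hW'X.trans hX, ?_, hW'⟩
    have h1 : W'.encard ≤ ((r + k : ℕ) : ℕ∞) := by
      rw [hW']
      calc M.eRk W' + k ≤ M.eRk X + k := by gcongr; exact M.eRk_mono hW'X
        _ ≤ (r : ℕ∞) + k := by gcongr
        _ = ((r + k : ℕ) : ℕ∞) := by push_cast; rfl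
    rw [← hW'fin.cast_ncard_eq] at h1
    exact_mod_cast h1
  apply hns
  rcases Nat.lt_or_ge X.ncard (r + 6) with h5 | h6
  · obtain ⟨W', hW'E, hW'n, hW'⟩ := key 5 (by omega)
    exact ⟨W', hW'E, Or.inr ⟨by omega, hW'⟩⟩
  · obtain ⟨W', hW'E, hW'n, hW'⟩ := key 6 (by omega)
    exact ⟨W', hW'E, Or.inl ⟨by omega, hW'⟩⟩

end S2

namespace ThmN

open Set

variable {α : Type}

/-- `Φ(16, 5)/2 ≤ 2^20 / C(21, 5)` (the scaled weight of the coloop step at `(16, 7)`). -/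
theorem phiK_sixteen_five_scaled : phiK 16 5 / 2 ≤ (2 : ℚ) ^ (15 + 5) / ((20349 : ℕ) : ℚ) := by
  have h := phiK_le_two_pow_div 16 5
  rw [Nat.choose_symm_add] at h
  have hc : ((16 + 5).choose 5 : ℚ) = 20349 := by norm_num [Nat.choose]
  rw [hc] at h
  have e1 : (2 : ℚ) ^ (16 + 5) = 2 * 2 ^ (15 + 5) := by norm_num
  rw [e1] at h
  push_cast
  linarith

/-- The standard caps at `(15, 7)`: `s₃ ≤ 11`, `s₄ ≤ 69`, `s₅ ≤ 401` on every `e`-free core of rank `15` on `22` points. -/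
theorem caps_fifteen_seven (M : Matroid α) [M.Finite]
    (hR : M.eRank = ((15 : ℕ) : ℕ∞)) (hn : M.E.ncard = 15 + 7)
    (hfree : ∀ e ∈ M.E, ∃ A ⊆ M.E \ {e}, e ∉ M.closure A ∧ e ∉ M.closure ((M.E \ {e}) \ A)) :
    {C : Set α | M.IsCircuit C ∧ C.ncard = 3}.ncard ≤ 11 ∧
      {C : Set α | M.IsCircuit C ∧ C.ncard = 4}.ncard ≤ 69 ∧
        {C : Set α | M.IsCircuit C ∧ C.ncard = 5}.ncard ≤ 401 := by
  have hd : M.E.encard = M.eRank + ((7 : ℕ) : ℕ∞) := by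
    rw [hR, ← M.ground_finite.cast_ncard_eq, hn]
    push_cast
    ring
  have hs3 := TriangleCap.core_ncard_triangles_le_cq3 M hfree hd
  rw [show TriangleCap.cq3 7 = 11 by decide] at hs3
  have hs4 := ncard_fourCircuits_le_avgChain16 7 M hfree hd
  rw [avgChain16_values.1] at hs4
  have hs5 := S1.ncard_fiveCircuits_le_avgChain5b 7 M hfree hd
  rw [S1.avgChain5b_values.1] at hs5
  exact ⟨hs3, hs4, hs5⟩

/-- **The top count on a spread `(15, 7)` core**: rank-`5` sets `≤ 9` points and rank-`4` sets `≤ 8` give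
`#U(15, 5) ≤ 72,721` (the partition count with `f = 9`, `f' = 8`: the `7`-sets weigh `3/5`, no giant term). -/
theorem topCount_le_spread_fifteen_seven (M : Matroid α) [M.Finite]
    (hR : M.eRank = ((15 : ℕ) : ℕ∞)) (hn : M.E.ncard = 15 + 7)
    (hfree : ∀ e ∈ M.E, ∃ A ⊆ M.E \ {e}, e ∉ M.closure A ∧ e ∉ M.closure ((M.E \ {e}) \ A))
    (hflat : ∀ X ⊆ M.E, M.eRk X ≤ 5 → X.ncard ≤ 9)
    (hflat' : ∀ X ⊆ M.E, M.eRk X ≤ 4 → X.ncard ≤ 8) :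
    Matroid.topCount M 15 5 ≤ 72721 := by
  classical
  have hL0 : ∀ e ∈ M.E, ¬ M.IsLoop e := not_isLoop_of_free M hfree
  have hs : ∀ e ∈ M.E, ∀ f ∈ M.E, e ≠ f → M.eRk {e, f} = 2 := by
    intro e he f hf hef
    have h2 : (2 : ℕ∞) ≤ M.eRk {e, f} :=
      two_le_eRk_of_two_le_ncard_of_free M hfree (pair_subset he hf) (by rw [ncard_pair hef])
    have h3 : M.eRk {e, f} ≤ 2 := by
      have := M.eRk_le_encard {e, f}
      rwa [encard_pair hef] at this
    exact le_antisymm h3 h2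
  have hcirc : ∀ C, M.IsCircuit C → 3 ≤ C.encard := three_le_encard_of_circuit M hL0 hs
  have hd : M.E.encard = M.eRank + ((7 : ℕ) : ℕ∞) := by
    rw [hR, ← M.ground_finite.cast_ncard_eq, hn]
    push_cast
    ring
  have hC1 : ∀ L ⊆ M.E, M.eRk L = 2 → L.ncard ≤ 3 :=
    fun L hL hr => ncard_le_three_of_eRk_two M hs hfree hL hr
  have hC2 : ∀ P ⊆ M.E, M.eRk P ≤ 3 → P.ncard ≤ 6 :=
    fun P hP hr => ncard_le_six_of_eRk_le_three_of_free M hfree hP hr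
  have hs6 : {C | M.IsCircuit C ∧ C.ncard = 6}.ncard ≤ (7 + 5).choose 6 :=
    Matroid.ncard_circuits_le_choose_of_encard M hd 5
  obtain ⟨hs3, hs4, hs5⟩ := caps_fifteen_seven M hR hn hfree
  have hflat'' : ∀ X ⊆ M.E, M.eRk X ≤ ((5 - 1 : ℕ) : ℕ∞) → X.ncard ≤ 8 := fun X hX hr =>
    hflat' X hX (by simpa using hr)
  have hU0 := S2.ncard_eRk_eq_ncard_le_le_sets_indep_quart M 5 9 8 7 6 7 (by norm_num)
    hcirc hC1 hC2 hflat hflat'' (hinter_five M hfree) hd (by omega) (by omega) (by omega)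
  have hU1 := Matroid.topCount_le_ncard_compl (M := M) hR hd 5
  simp only [show (5 : ℕ) + 1 = 6 from rfl] at hU0
  rw [hn, sum_Icc_three_six_q] at hU0
  simp only [show (6 : ℕ) - 3 = 3 from rfl, show (6 : ℕ) - 4 = 2 from rfl,
    show (6 : ℕ) - 5 = 1 from rfl, show (6 : ℕ) - 6 = 0 from rfl, Nat.choose_one_right,
    Nat.choose_zero_right] at hU0
  norm_num [Finset.sum_range_succ, Nat.choose] at hU0
  have hI5 := S2.ncard_indep_five_add_le (M := M) hC1
  rw [hn] at hI5
  have hch : ({C : Set α | M.IsCircuit C ∧ C.ncard = 3}.ncard).choose 2 ≤ (11 : ℕ).choose 2 :=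
    Nat.choose_le_choose 2 hs3
  have hI5' : {B : Set α | B ⊆ M.E ∧ B.ncard = 5 ∧ M.eRk B = 5}.ncard ≤ 26389 := by
    have h1 : (15 + 7).choose 5 = 26334 := by decide
    have h2 : (11 : ℕ).choose 2 = 55 := by decide
    omega
  have hU1q : (Matroid.topCount M 15 5 : ℚ) ≤
      ({B : Set α | B ⊆ M.E ∧ M.eRk B = 5 ∧ B.ncard ≤ 7}.ncard : ℚ) := by exact_mod_cast hU1
  have hI5q : ({B : Set α | B ⊆ M.E ∧ B.ncard = 5 ∧ M.eRk B = 5}.ncard : ℚ) ≤ 26389 := by exact_mod_cast hI5'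
  have hs3q : ({C : Set α | M.IsCircuit C ∧ C.ncard = 3}.ncard : ℚ) ≤ 11 := by exact_mod_cast hs3
  have hs4q : ({C : Set α | M.IsCircuit C ∧ C.ncard = 4}.ncard : ℚ) ≤ 69 := by exact_mod_cast hs4
  have hs5q : ({C : Set α | M.IsCircuit C ∧ C.ncard = 5}.ncard : ℚ) ≤ 401 := by exact_mod_cast hs5
  have hs6q : ({C : Set α | M.IsCircuit C ∧ C.ncard = 6}.ncard : ℚ) ≤ 924 := by
    have h : (7 + 5).choose 6 = 924 := by decide
    rw [h] at hs6
    exact_mod_cast hs6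
  have hfin : (Matroid.topCount M 15 5 : ℚ) ≤ 72721 := by
    linarith [hU1q, hU0, hI5q, hs3q, hs4q, hs5q, hs6q]
  exact_mod_cast hfin

/-- The tail side of the scaled cell `(15, 7)` on the caps `11 / 69 / 401`: `T = 423,728 ≤ 104·2^22/1024`. -/
theorem tail_fifteen_seven :
    1024 * ((((15 + 7).choose 4 : ℚ) +
      (∑ j ∈ Finset.range 6, (Nat.choose (min 5 ((7 + 3) / 2 + 1 - 2)) j : ℚ) / (((j + 1) + 3 * (j + 1).choose 2 + 3 * (j + 1).choose 3 + 2 * (j + 1).choose 4 : ℕ) : ℚ)) *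
        ((11 * (15 + 7 - 3).choose 2 + 69 * (15 + 7 - 4) + 401 : ℕ) : ℚ) +
      ((∑ j ∈ Finset.range 6, (Nat.choose 5 j : ℚ) / (((j + 1) + 3 * (j + 1).choose 2 + 3 * (j + 1).choose 3 + 2 * (j + 1).choose 4 : ℕ) : ℚ)) -
        (∑ j ∈ Finset.range 6, (Nat.choose (min 5 ((7 + 3) / 2 + 1 - 2)) j : ℚ) / (((j + 1) + 3 * (j + 1).choose 2 + 3 * (j + 1).choose 3 + 2 * (j + 1).choose 4 : ℕ) : ℚ))) *
        ((10 : ℕ).choose 5 : ℚ)) +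
      (((15 + 7).choose 3 * 2 ^ 3 + (15 + 7).choose 2 * 2 + (15 + 7) + 1 : ℕ) : ℚ) +
      (((15 + 7).choose 5 : ℚ) + (∑ j ∈ Finset.range (7), (Nat.choose (min 13 ((7 + 6) / 2 + 1 - 2)) j : ℚ) / (((j + 1) + 3 * (j + 1).choose 2 + 3 * (j + 1).choose 3 + 2 * (j + 1).choose 4 : ℕ) : ℚ)) * ((11 * (15 + 7 - 3).choose 3 + 69 * (15 + 7 - 4).choose 2 + 401 * (15 + 7 - 5) + (7 + 5).choose 6 : ℕ) : ℚ) +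
        ((∑ j ∈ Finset.range (7), (Nat.choose (min 19 (5 + 7) - 6) j : ℚ) / (((j + 1) + 3 * (j + 1).choose 2 + 3 * (j + 1).choose 3 + 2 * (j + 1).choose 4 : ℕ) : ℚ)) - (∑ j ∈ Finset.range (7), (Nat.choose (min 13 ((7 + 6) / 2 + 1 - 2)) j : ℚ) / (((j + 1) + 3 * (j + 1).choose 2 + 3 * (j + 1).choose 3 + 2 * (j + 1).choose 4 : ℕ) : ℚ))) *
        ((min 19 (5 + 7)).choose 6 : ℚ)) +
      ((∑ j ∈ Finset.range (7 + 1), (15 + 7).choose j : ℕ) : ℚ)) ≤ (104 : ℚ) * 2 ^ (15 + 7) := by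
  have hsm : (∑ j ∈ Finset.range (7), (Nat.choose (min 13 ((7 + 6) / 2 + 1 - 2)) j : ℚ) / (((j + 1) + 3 * (j + 1).choose 2 + 3 * (j + 1).choose 3 + 2 * (j + 1).choose 4 : ℕ) : ℚ)) = 12767 / 4230 := by
    norm_num [Finset.sum_range_succ, Nat.choose]
  have hsg : (∑ j ∈ Finset.range (7), (Nat.choose (min 19 (5 + 7) - 6) j : ℚ) / (((j + 1) + 3 * (j + 1).choose 2 + 3 * (j + 1).choose 3 + 2 * (j + 1).choose 4 : ℕ) : ℚ)) = 414767 / 103635 := by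
    norm_num [Finset.sum_range_succ, Nat.choose]
  have hs4m : (∑ j ∈ Finset.range 6, (Nat.choose (min 5 ((7 + 3) / 2 + 1 - 2)) j : ℚ) / (((j + 1) + 3 * (j + 1).choose 2 + 3 * (j + 1).choose 3 + 2 * (j + 1).choose 4 : ℕ) : ℚ)) = 523 / 225 := by
    norm_num [Finset.sum_range_succ, Nat.choose]
  have hs4g : (∑ j ∈ Finset.range 6, (Nat.choose 5 j : ℚ) / (((j + 1) + 3 * (j + 1).choose 2 + 3 * (j + 1).choose 3 + 2 * (j + 1).choose 4 : ℕ) : ℚ)) = 12767 / 4230 := by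
    norm_num [Finset.sum_range_succ, Nat.choose]
  rw [hsm, hsg, hs4m, hs4g]
  simp only [Finset.sum_range_succ, Finset.sum_range_zero]
  norm_num [Nat.choose]

/-- **The scaled cell `(15, 7)` from a bound on the coindependent `5`-sets**: `V ≤ 15,030` gives
`Φ(16, 5)/2 · #U(15, 5) ≤ #Y(15, 5)` (caps `11 / 69 / 401`, slack `104/1024`). -/
theorem c025_fifteen_seven_scaled_of_payment_five (M : Matroid α) [M.Finite]
    (hR : M.eRank = ((15 : ℕ) : ℕ∞)) (hn : M.E.ncard = 15 + 7)
    (hfree : ∀ e ∈ M.E, ∃ A ⊆ M.E \ {e}, e ∉ M.closure A ∧ e ∉ M.closure ((M.E \ {e}) \ A))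
    (V : ℕ) (hV : {B : Set α | B ⊆ M.E ∧ B.ncard = 5 ∧ M.eRk (M.E \ B) = M.eRank}.ncard ≤ V)
    (hV' : V ≤ 15030) :
    phiK 16 5 / 2 * (Matroid.topCount M 15 5 : ℚ) ≤ (Matroid.midCount M 15 5 : ℚ) := by
  obtain ⟨hs3, hs4, hs5⟩ := caps_fifteen_seven M hR hn hfree
  have hVq : (V : ℚ) ≤ 15030 := by exact_mod_cast hV'
  refine c025_core_five_payment_cell_xqictq5g M 15 7 (by norm_num) hR hn hfree 11 69 401 hs3 hs4 hs5 V hV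
    20349 (by norm_num) (phiK 16 5 / 2) phiK_sixteen_five_scaled ⟨104, by norm_num, ?_, tail_fifteen_seven⟩
  norm_num [Finset.sum_range_succ, Nat.choose]
  linarith

/-- **The scaled cell `(15, 7)` on a set `W` of nullity `6` with `≤ 15` points** (`V(w, 6) ≤ 12,558`). -/
theorem c025_fifteen_seven_scaled_of_nullity_six (M : Matroid α) [M.Finite]
    (hR : M.eRank = ((15 : ℕ) : ℕ∞)) (hn : M.E.ncard = 15 + 7)
    (hfree : ∀ e ∈ M.E, ∃ A ⊆ M.E \ {e}, e ∉ M.closure A ∧ e ∉ M.closure ((M.E \ {e}) \ A))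
    {W : Set α} (hW : W ⊆ M.E) (hWn : W.ncard ≤ 15) (hWk : W.encard = M.eRk W + 6) :
    phiK 16 5 / 2 * (Matroid.topCount M 15 5 : ℚ) ≤ (Matroid.midCount M 15 5 : ℚ) := by
  have hd : M.E.encard = M.eRank + ((7 : ℕ) : ℕ∞) := by
    rw [hR, ← M.ground_finite.cast_ncard_eq, hn]
    push_cast
    ring
  have hV := S2.ncard_spanning_compl_le_of_nullity M hW hd hWk (m := 5)
  have hsum : ∑ j ∈ Finset.Icc (5 + 6 - 7) 5, W.ncard.choose j * (M.E.ncard - W.ncard).choose (5 - j) ≤ 12558 := by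
    rw [hn]
    generalize W.ncard = w at hWn ⊢
    interval_cases w <;> decide
  exact c025_fifteen_seven_scaled_of_payment_five M hR hn hfree 12558 (hV.trans hsum) (by norm_num)

/-- **The scaled cell `(15, 7)` on a set `W` of nullity `5` with `≤ 11` points** (`V(w, 5) ≤ 13,167`). -/
theorem c025_fifteen_seven_scaled_of_nullity_five (M : Matroid α) [M.Finite]
    (hR : M.eRank = ((15 : ℕ) : ℕ∞)) (hn : M.E.ncard = 15 + 7)
    (hfree : ∀ e ∈ M.E, ∃ A ⊆ M.E \ {e}, e ∉ M.closure A ∧ e ∉ M.closure ((M.E \ {e}) \ A))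
    {W : Set α} (hW : W ⊆ M.E) (hWn : W.ncard ≤ 11) (hWk : W.encard = M.eRk W + 5) :
    phiK 16 5 / 2 * (Matroid.topCount M 15 5 : ℚ) ≤ (Matroid.midCount M 15 5 : ℚ) := by
  have hd : M.E.encard = M.eRank + ((7 : ℕ) : ℕ∞) := by
    rw [hR, ← M.ground_finite.cast_ncard_eq, hn]
    push_cast
    ring
  have hV := S2.ncard_spanning_compl_le_of_nullity M hW hd hWk (m := 5)
  have hsum : ∑ j ∈ Finset.Icc (5 + 5 - 7) 5, W.ncard.choose j * (M.E.ncard - W.ncard).choose (5 - j) ≤ 13167 := by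
    rw [hn]
    generalize W.ncard = w at hWn ⊢
    interval_cases w <;> decide
  exact c025_fifteen_seven_scaled_of_payment_five M hR hn hfree 13167 (hV.trans hsum) (by norm_num)

/-- **The scaled cell `(15, 7)` on a spread core** (rank-`5` sets `≤ 9`, rank-`4` sets `≤ 8`: `#U ≤ 72,721` against `73,129`). -/
theorem c025_fifteen_seven_scaled_of_spread (M : Matroid α) [M.Finite]
    (hR : M.eRank = ((15 : ℕ) : ℕ∞)) (hn : M.E.ncard = 15 + 7)
    (hfree : ∀ e ∈ M.E, ∃ A ⊆ M.E \ {e}, e ∉ M.closure A ∧ e ∉ M.closure ((M.E \ {e}) \ A))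
    (hflat : ∀ X ⊆ M.E, M.eRk X ≤ 5 → X.ncard ≤ 9)
    (hflat' : ∀ X ⊆ M.E, M.eRk X ≤ 4 → X.ncard ≤ 8) :
    phiK 16 5 / 2 * (Matroid.topCount M 15 5 : ℚ) ≤ (Matroid.midCount M 15 5 : ℚ) := by
  obtain ⟨hs3, hs4, hs5⟩ := caps_fifteen_seven M hR hn hfree
  have hU := topCount_le_spread_fifteen_seven M hR hn hfree hflat hflat'
  refine c025_core_five_cell_of_topCount_xqictq5g M 15 7 (by norm_num) hR hn hfree 11 69 401 hs3 hs4 hs5 72721 hU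
    20349 (by norm_num) (phiK 16 5 / 2) phiK_sixteen_five_scaled ⟨104, by norm_num, ?_, tail_fifteen_seven⟩
  norm_num [Nat.choose]

/-- **The scaled cell `(15, 7)`**: `Φ(16, 5)/2 · #U(15, 5) ≤ #Y(15, 5)` on every `e`-free core of rank `15` on `22` points
(concentrated or spread). -/
theorem c025_fifteen_seven_scaled (M : Matroid α) [M.Finite]
    (hR : M.eRank = ((15 : ℕ) : ℕ∞)) (hn : M.E.ncard = 15 + 7)
    (hfree : ∀ e ∈ M.E, ∃ A ⊆ M.E \ {e}, e ∉ M.closure A ∧ e ∉ M.closure ((M.E \ {e}) \ A)) :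
    phiK 16 5 / 2 * (Matroid.topCount M 15 5 : ℚ) ≤ (Matroid.midCount M 15 5 : ℚ) := by
  classical
  by_cases hc : ∃ W ⊆ M.E, (W.ncard ≤ 15 ∧ W.encard = M.eRk W + 6) ∨ (W.ncard ≤ 11 ∧ W.encard = M.eRk W + 5)
  · obtain ⟨W, hW, h6 | h5⟩ := hc
    · exact c025_fifteen_seven_scaled_of_nullity_six M hR hn hfree hW h6.1 h6.2
    · exact c025_fifteen_seven_scaled_of_nullity_five M hR hn hfree hW h5.1 h5.2
  · exact c025_fifteen_seven_scaled_of_spread M hR hn hfree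
      (fun X hX hr => S2.ncard_le_of_eRk_le_of_not_concentrated_two M hc hX (by norm_num) hr)
      (fun X hX hr => S2.ncard_le_of_eRk_le_of_not_concentrated_two M hc hX (by norm_num) hr)

/-- **The cell `(16, 7)` with a coloop**: `e` a coloop of the `e`-free core of rank `16` on `23` points ⇒ `RLS M 16 5`
(the scaled cell `(15, 7)` on `M ＼ {e}`, lifted by `weighted_of_isColoop_scaled`). -/
theorem c025_sixteen_seven_of_coloop (M : Matroid α) [M.Finite]
    (hR : M.eRank = ((16 : ℕ) : ℕ∞)) (hn : M.E.ncard = 16 + 7)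
    (hfree : ∀ e ∈ M.E, ∃ A ⊆ M.E \ {e}, e ∉ M.closure A ∧ e ∉ M.closure ((M.E \ {e}) \ A))
    {e : α} (he : M.IsColoop e) : RLS M 16 5 := by
  classical
  obtain ⟨hn', hR', hfree', -⟩ := delete_core_data M he (p := 15) (d := 7) (by rw [hR]) hn hfree
  have key := c025_fifteen_seven_scaled (M ＼ {e}) hR' hn' hfree'
  rw [RLS_iff]
  exact weighted_of_isColoop_scaled M he (by norm_num : 4 + 1 < 15) (by rw [hR]) (phiK 16 5) key

/-- **THE CELL `(16, 7)` OF THE `q = 5` WINDOW**: `RLS M 16 5` for every finite `e`-free matroid of rank `16` on `23` points —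
a coloop (the scaled `(15, 7)` cell) or none (S2SpreadSixteenSeven's `c025_sixteen_seven_coloop_free`). -/
theorem c025_core_five_sixteen_seven (M : Matroid α) [M.Finite]
    (hR : M.eRank = ((16 : ℕ) : ℕ∞)) (hn : M.E.ncard = 16 + 7)
    (hfree : ∀ e ∈ M.E, ∃ A ⊆ M.E \ {e}, e ∉ M.closure A ∧ e ∉ M.closure ((M.E \ {e}) \ A)) : RLS M 16 5 := by
  classical
  by_cases hK : ∃ e, M.IsColoop e
  · obtain ⟨e, he⟩ := hK
    exact c025_sixteen_seven_of_coloop M hR hn hfree he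
  · push Not at hK
    exact c025_sixteen_seven_coloop_free M hR hn hfree hK

end ThmN

end PercRepro
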